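import Mathlib
import HarnessLib
import Summits.HubbardSuperconductivity.HubbardSuperconductivity.Theorems.KLProgrammeKLRegimeEngineTowerBlockZeroKitUnits
import Summits.HubbardSuperconductivity.HubbardSuperconductivity.Theorems.KLProgrammeKLRegimeEngineTowerWtFullInputs
import Summits.HubbardSuperconductivity.HubbardSuperconductivity.Theorems.KLProgrammeKLRegimeEngineTowerLevUnitsDefs
import Summits.HubbardSuperconductivity.HubbardSuperconductivity.Theorems.KLProgrammeKLRegimeEngineTowerBlockIncrWtKitUnits

/-!
# Route `KLProgramme` — crux K3 ENGINE (stmt-HubbardSuperconductivity-20437 `KLRegimeEngineV17F2`), stub (b) v2, THE LEVELS PACKAGE (ℓ), (I1)→(I7) LINK at BLOCK 0: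
# the levelled block-`0` step in the kit's LITERAL `hstep` shape at the named UV array `μ_kit0 m := W₀·Z₀^m·(klTowerUVLev … (2m)/ε^{2m−1})`
# («(I1)-BLOCK0-LINK»; cell gate-hubbard-kl, seat p4 g18)

Block `0` reads its input `𝒱_0` in the TRIVIAL family (k3c2-p3's «(I1)-BLOCK0» `klTowerBornLev_zero_le_kit_units`, …BlockZeroKitUnits; input bridge
`towerInputZero_prescribed_le_klTowerUVLev`, …WtFullInputs).  Instantiated at `B m Fc := klTowerUVLev … (2m)`, `u := ε²`, `Kc := ε⁻²`, `μd m := ε·μ0 m`,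
`μ0 m := klTowerUVLev … (2m)/ε^{2m−1}` (UNITS-MAP §(4)), divided by `klLevUnit … t p 0 = ε^{2p−1}` and re-scaled (`kitStep_abs_eq_units_mul`) it is the kit's `hstep` at
`k = 0` for `klTowerBLev … d t 1 p`, with `μ_kit0 m = W₀·Z₀^m·μ0 m`, **`W₀ = e²cr/(2cc)`, `Z₀ = e⁴cc²ε²`, `σ = κ²/(e⁴cc²)`, `τ = τ₀/(e⁴cc²)`, `ψ = ψ₀e⁴cc²`,
`Φ = 2αcc/(eκ²cr)`** (the `8^{dk}`-free, un-doubled block-0 values of `klTowerBLev_succ_le_kitStep`'s parameters).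

* `klTowerUVLev_degree_zero` (`Z ≠ 0` ⇒ no constant part ⇒ the degree-0 UV size vanishes), **`klTowerBLev_one_le_kitStep`**.
Compositions of landed theorems and real algebra; nothing asserts (ℓ), any stub, K3 or superconductivity.
References: BGM 2006 §2.8 (2.76)–(2.84), §3 (3.2)–(3.8) [cite: BenfattoGiulianiMastropietro2006].
-/

noncomputable section

namespace Summit.HubbardSuperconductivity.HubbardSuperconductivity.Theorems.EngineV8

set_option linter.dupNamespace false -- summit = problem name (single-conjunct summit), D-0017

open Classical
open Real Finset Literature.MathematicalPhysics.QuantumLattice Literature.Probability.LatticeModels GrassmannAlgebra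
open Literature.MathematicalPhysics.QuantumLattice.FermiRG
open Summit.HubbardSuperconductivity.HubbardSuperconductivity.Theorems.KLProgrammeLegKernels
open Summit.HubbardSuperconductivity.HubbardSuperconductivity.Theorems.KLRegimeSplit
open Summit.HubbardSuperconductivity.HubbardSuperconductivity.Theorems.KLRegimeWick
open Summit.HubbardSuperconductivity.HubbardSuperconductivity.Theorems.TwoPointAssembly
open Summit.HubbardSuperconductivity.HubbardSuperconductivity.Theorems.DispersionFlow

variable {L M : ℕ} [NeZero L] [NeZero M]

omit [NeZero M] in
/-- **No constant part ⇒ the degree-`0` UV size vanishes**: `klTowerUVLev … 0 = 0` when `Z^K_{Λ_0} ≠ 0`. -/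
theorem klTowerUVLev_degree_zero (β U μ : ℝ) (K : TrigPolyC4v) (hZ : hubbardEffPartitionFnCT L M β U μ 0 K (klScale klE0 0) ≠ 0) :
    klTowerUVLev L M β U μ K 0 = 0 := by
  have hG0 : constPart ℂ (klEffectiveAction L M β U μ K klE0 0) = 0 := constPart_klEffectiveAction_eq_zero β U μ K klE0 0 hZ
  unfold klTowerUVLev
  rw [hubbardSectorKernelNorm_def, sectorisedKernelNorm_zero_left]
  refine sum_eq_zero fun Ω _ => ?_
  rw [norm_eq_zero]
  unfold sectorisedKernel
  simp [kernel_zero, hG0]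

/-- **THE BLOCK-`0` LEVELLED STEP IN THE KIT's LITERAL SHAPE** at `μ_kit0 m = W₀·Z₀^m·(klTowerUVLev … (2m)/ε^{2m−1})` (see the module docstring).
[cite: BenfattoGiulianiMastropietro2006, §2.8 (2.76)-(2.84), §3 (3.2)-(3.8)] -/
theorem klTowerBLev_one_le_kitStep {β : ℝ} (hβ : 0 < β) (U μ : ℝ) (K : TrigPolyC4v) (d : ℕ)
    (hZ : hubbardEffPartitionFnCT L M β U μ 0 K (klScale klE0 0) ≠ 0)
    {κ : ℝ} (hκ : 0 < κ)
    (hGB : IsGramBoundedR ((sectorSubMatrix L M β (trivialMultiplier L M)).transpose *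
      hubbardCovSliceCT L M β μ 0 K (klScale klE0 d) (klScale klE0 0) * sectorSubMatrix L M β (trivialMultiplier L M)) κ)
    {α : ℝ} (hα : 0 < α)
    (hrow : ∀ X, ∑ Y, ‖((sectorSubMatrix L M β (trivialMultiplier L M)).transpose *
        hubbardCovSliceCT L M β μ 0 K (klScale klE0 d) (klScale klE0 0) * sectorSubMatrix L M β (trivialMultiplier L M)) X Y‖ ≤ α)
    (hcol : ∀ Y, ∑ X, ‖((sectorSubMatrix L M β (trivialMultiplier L M)).transpose *
        hubbardCovSliceCT L M β μ 0 K (klScale klE0 d) (klScale klE0 0) * sectorSubMatrix L M β (trivialMultiplier L M)) X Y‖ ≤ α)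
    {ρ : ℝ} (hρ : 0 < ρ)
    {cr cc : ℝ} (hcr : 0 < cr) (hcc : 0 < cc)
    (hrow' : ∀ X'', ∑ X', ‖(sectorAnalysisMatrix L M β (klAnisoFamily L M β μ K klE0 0) * sectorSubMatrix L M β (trivialMultiplier L M)) X'' X'‖ ≤ cr)
    (hcol' : ∀ X', ∑ X'', ‖(sectorAnalysisMatrix L M β (klAnisoFamily L M β μ K klE0 0) * sectorSubMatrix L M β (trivialMultiplier L M)) X'' X'‖ ≤ cc)
    {D : ℕ} (hD : Fintype.card (SpaceTimeIdx L M × SectorLeg 1) / 2 ≤ D)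
    {N : ℕ} (hN : 1 ≤ N)
    {τ₀ ψ₀ : ℝ} (hτ1 : (exp 3 * κ) ^ 2 ≤ τ₀) (hτ2 : (exp 2 * (κ + ρ)) ^ 2 ≤ τ₀) (hψ1 : κ⁻¹ ^ 2 ≤ ψ₀) (hψ2 : ρ⁻¹ ^ 2 ≤ ψ₀)
    (hguard : 2 * α * cc / (exp 1 * κ ^ 2 * cr) *
      towerV D (τ₀ / (exp 4 * cc ^ 2))
        (fun m => exp 2 * cr / (2 * cc) * (exp 4 * cc ^ 2 * imagTimeWeight β M ^ 2) ^ m *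
          (klTowerUVLev L M β U μ K (2 * m) / imagTimeWeight β M ^ (2 * m - 1))) < 1)
    (t : Fin 5) (q : ℕ) :
    klTowerBLev L M β U μ K d t 1 (q + 1) ≤
      towerFO D (κ ^ 2 / (exp 4 * cc ^ 2))
          (fun m => exp 2 * cr / (2 * cc) * (exp 4 * cc ^ 2 * imagTimeWeight β M ^ 2) ^ m *
            (klTowerUVLev L M β U μ K (2 * m) / imagTimeWeight β M ^ (2 * m - 1))) (q + 1) +
        ∑ n ∈ Icc 2 N, exp 1 * (2 * α * cc / (exp 1 * κ ^ 2 * cr)) ^ (n - 1) * (ψ₀ * (exp 4 * cc ^ 2)) ^ (q + 1) *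
          towerS D (τ₀ / (exp 4 * cc ^ 2))
            (fun m => exp 2 * cr / (2 * cc) * (exp 4 * cc ^ 2 * imagTimeWeight β M ^ 2) ^ m *
              (klTowerUVLev L M β U μ K (2 * m) / imagTimeWeight β M ^ (2 * m - 1))) n (q + 1) +
        (ψ₀ * (exp 4 * cc ^ 2)) ^ (q + 1) * exp 1 *
          towerV D (τ₀ / (exp 4 * cc ^ 2))
            (fun m => exp 2 * cr / (2 * cc) * (exp 4 * cc ^ 2 * imagTimeWeight β M ^ 2) ^ m *
              (klTowerUVLev L M β U μ K (2 * m) / imagTimeWeight β M ^ (2 * m - 1))) *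
          (2 * α * cc / (exp 1 * κ ^ 2 * cr) *
            towerV D (τ₀ / (exp 4 * cc ^ 2))
              (fun m => exp 2 * cr / (2 * cc) * (exp 4 * cc ^ 2 * imagTimeWeight β M ^ 2) ^ m *
                (klTowerUVLev L M β U μ K (2 * m) / imagTimeWeight β M ^ (2 * m - 1)))) ^ N /
          (1 - 2 * α * cc / (exp 1 * κ ^ 2 * cr) *
            towerV D (τ₀ / (exp 4 * cc ^ 2))
              (fun m => exp 2 * cr / (2 * cc) * (exp 4 * cc ^ 2 * imagTimeWeight β M ^ 2) ^ m *
                (klTowerUVLev L M β U μ K (2 * m) / imagTimeWeight β M ^ (2 * m - 1)))) := by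
  have hx : 0 < imagTimeWeight β M := imagTimeWeight_pos_of_pos (M := M) hβ
  -- abbreviations
  set ε := imagTimeWeight β M with hε
  set μ0 : ℕ → ℝ := fun m => klTowerUVLev L M β U μ K (2 * m) / ε ^ (2 * m - 1) with hμ0
  set W : ℝ := exp 2 * cr / (2 * cc) with hW
  set Zc : ℝ := exp 4 * cc ^ 2 * ε ^ 2 with hZc
  set μd : ℕ → ℝ := fun m => ε * ((1 : ℝ) ^ m * μ0 m) with hμd
  have hW0 : 0 < W := by positivity
  have hZ0 : 0 < Zc := by positivity
  have hμ00 : ∀ m, 0 ≤ μ0 m := fun m => div_nonneg (klTowerUVLev_nonneg hβ.le U μ K _) (by positivity)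
  have hμd0 : ∀ m, 0 ≤ μd m := fun m => by have := hμ00 m; positivity
  have hμd00 : μd 0 = 0 := by simp [hμd, hμ0, klTowerUVLev_degree_zero β U μ K hZ]
  -- the majorant: `ε·UV(2m) ≤ (ε·ε⁻²)·((ε²)^m·μd m)` (an identity)
  have hNB : ∀ m c, (1 : ℝ) ^ c * (ε * klTowerUVLev L M β U μ K (2 * m)) ≤ (ε * (ε ^ 2)⁻¹) * ((ε ^ 2) ^ m * μd m) := by
    intro m c
    rcases Nat.eq_zero_or_pos m with rfl | hm
    · simp [klTowerUVLev_degree_zero β U μ K hZ, hμd00]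
    · refine le_of_eq ?_
      rw [hμd, hμ0]
      dsimp only
      rw [one_pow, one_pow, one_mul, one_mul, ← pow_mul]
      obtain ⟨m', rfl⟩ : ∃ m', m = m' + 1 := ⟨m - 1, by omega⟩
      rw [show 2 * (m' + 1) - 1 = 2 * m' + 1 by omega, show 2 * (m' + 1) = 2 * m' + 2 by ring]
      field_simp
      ring
  -- the row at `N₀ := N + 1`
  have hN₀ : 2 ≤ N + 1 := by omega
  have hrow := klTowerBornLev_zero_le_kit_units (L := L) (M := M) hβ U μ K d hZ hκ hGB (fun m _ => klTowerUVLev L M β U μ K (2 * m))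
    (fun m _ => klTowerUVLev_nonneg hβ.le U μ K _) (fun m' Fc E τ' q' hq hE y => towerInputZero_prescribed_le_klTowerUVLev hβ.le U μ K m' Fc E τ' q' hq hE y)
    hα hrow hcol hρ hcr.le hcc.le hrow' hcol' hN₀ (u := ε ^ 2) (Kc := (ε ^ 2)⁻¹) (by positivity) (by positivity) hμd0 hμd00 hNB hD hτ1 hτ2 hψ1 hψ2 ?_
    q ((t : ℕ) + 1)
  swap
  · -- the row's guard from the kit guard
    have hVu : towerV D (τ₀ * ε ^ 2) μd = ε * towerV D (τ₀ * ε ^ 2 * 1) μ0 := by rw [hμd]; exact towerV_units D (τ₀ * ε ^ 2) ε 1 μ0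
    have hVk : towerV D (τ₀ / (exp 4 * cc ^ 2)) (fun m => W * Zc ^ m * (klTowerUVLev L M β U μ K (2 * m) / ε ^ (2 * m - 1))) =
        W * towerV D (τ₀ * ε ^ 2 * 1) μ0 := by
      have hf : (fun m => W * Zc ^ m * (klTowerUVLev L M β U μ K (2 * m) / ε ^ (2 * m - 1))) = fun m => W * (Zc ^ m * μ0 m) :=
        funext fun m => by simp only [hμ0]; ring
      rw [hf, towerV_units, show τ₀ / (exp 4 * cc ^ 2) * Zc = τ₀ * ε ^ 2 * 1 by rw [hZc]; field_simp]
    have hid : exp 1 * α / κ ^ 2 * (ε * (ε ^ 2)⁻¹) * (ε * towerV D (τ₀ * ε ^ 2 * 1) μ0) =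
        2 * α * cc / (exp 1 * κ ^ 2 * cr) * (W * towerV D (τ₀ * ε ^ 2 * 1) μ0) := by
      rw [hW]
      have he2 : exp 2 = exp 1 * exp 1 := by rw [← exp_add]; norm_num
      rw [he2]
      field_simp
    rw [← hε, hVu, hid, ← hVk]
    exact hguard
  -- divide by the unit `klLevUnit t (q+1) 0 = ε^{2q+1}`
  have hunit : klLevUnit β M t (q + 1) (d * 0) = ε ^ (2 * q + 1) := by
    rw [Nat.mul_zero]; unfold klLevUnit; simp [hε, show 2 * (q + 1) - 1 = 2 * q + 1 by omega]
  have hunit0 : 0 < klLevUnit β M t (q + 1) (d * 0) := klLevUnit_pos hβ t (q + 1) _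
  rw [klTowerBLev_succ, div_le_iff₀ hunit0, hunit]
  refine hrow.trans (le_of_eq ?_)
  -- first units identity: `μd = ε·(1^m·μ0)`
  have hU1 := kitStep_abs_eq_units_mul (K := ε) (u := (1 : ℝ)) hx.ne' one_ne_zero D (κ ^ 2 * ε ^ 2) (τ₀ * ε ^ 2)
    (exp 1 * α / κ ^ 2 * (ε * (ε ^ 2)⁻¹)) (ψ₀ / ε ^ 2) μ0 N (q + 1)
  rw [← hε, hμd]
  simp only [Nat.add_sub_cancel]
  rw [hU1]
  -- second units identity: `μ_kit0 = W·(Zc^m·μ0)`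
  have hf : (fun m => W * Zc ^ m * (klTowerUVLev L M β U μ K (2 * m) / ε ^ (2 * m - 1))) = fun m => W * (Zc ^ m * μ0 m) :=
    funext fun m => by simp only [hμ0]; ring
  have hU2 := kitStep_abs_eq_units_mul (K := W) (u := Zc) hW0.ne' hZ0.ne' D (κ ^ 2 / (exp 4 * cc ^ 2)) (τ₀ / (exp 4 * cc ^ 2))
    (2 * α * cc / (exp 1 * κ ^ 2 * cr)) (ψ₀ * (exp 4 * cc ^ 2)) μ0 N (q + 1)
  rw [hf, hU2]
  -- match the parameters
  have he2 : exp 2 = exp 1 * exp 1 := by rw [← exp_add]; norm_num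
  have he4 : exp 4 = exp 2 * exp 2 := by rw [← exp_add]; norm_num
  have hσ : κ ^ 2 / (exp 4 * cc ^ 2) * Zc = κ ^ 2 * ε ^ 2 * 1 := by rw [hZc]; field_simp
  have hτ : τ₀ / (exp 4 * cc ^ 2) * Zc = τ₀ * ε ^ 2 * 1 := by rw [hZc]; field_simp
  have hΦ : 2 * α * cc / (exp 1 * κ ^ 2 * cr) * W = exp 1 * α / κ ^ 2 * (ε * (ε ^ 2)⁻¹) * ε := by rw [hW, he2]; field_simp
  have hψ : ψ₀ * (exp 4 * cc ^ 2) / Zc = ψ₀ / ε ^ 2 / 1 := by rw [hZc]; field_simp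
  rw [hσ, hτ, hΦ, hψ]
  -- scalar prefactors: `(ε·e⁴cr/2)(ε·e²cc)^{2q+1}((ε²)^{q+1}ε⁻²)·(1^{q+1}·ε) = Zc^{q+1}·W·ε^{2q+1}`
  have hpre : (ε * (exp 4 / 2 * cr)) * (ε * (exp 2 * cc)) ^ (2 * q + 1) * ((ε ^ 2) ^ (q + 1) * (ε ^ 2)⁻¹) * ((1 : ℝ) ^ (q + 1) * ε) =
      Zc ^ (q + 1) * W * ε ^ (2 * q + 1) := by
    rw [hZc, hW, he4, he2]
    field_simp
    ring
  have hpre' : ∀ R : ℝ, (ε * (exp 4 / 2 * cr)) * (ε * (exp 2 * cc)) ^ (2 * q + 1) * ((ε ^ 2) ^ (q + 1) * (ε ^ 2)⁻¹) * ((1 : ℝ) ^ (q + 1) * ε * R) =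
      Zc ^ (q + 1) * W * R * ε ^ (2 * q + 1) := fun R => by linear_combination R * hpre
  exact hpre' _

end Summit.HubbardSuperconductivity.HubbardSuperconductivity.Theorems.EngineV8

end
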